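import Summits.QuantumFields.BalabanUV.T4Continuum.Support.NE7SliceStepNonlinear
import Summits.QuantumFields.BalabanUV.T4Continuum.Support.NE7SliceInductionRates
import Summits.QuantumFields.BalabanUV.T4Continuum.Support.NE7AxialGaugeData
import Summits.QuantumFields.BalabanUV.T4Continuum.Support.NE3ClassRadiusFamily
import Summits.QuantumFields.BalabanUV.T4Continuum.Support.AveragingDeficitKDatum
import HarnessLib

/-!
# NE7SliceInduction — THE SUP MEMBER OF REP♭ AT THE TRIVIAL FLAT DATUM, k- AND N-UNIFORMLY: in the fibre `cavgIter L (k+1) U = 1` of a unitary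
# `(L^{k+1}N)`-periodic field with plaquettes `ε`-close to `1`, there is a unitary periodic gauge `g`, PINNED at the top block corners (so the fibre
# is kept: `cavgIter L (k+1) U^g = 1`), with EVERY link `‖U^g − 1‖ ≤ C·L^{k+1}·ε = C·δ∕M` (`δ = M²ε`, `M = L^{k+1}`), as soon as `M²ε ≤ θ₀`;
# `C, θ₀ > 0` depend on `d`, `card n`, `L` only (`NE7SliceInduction`)

Cell `pub-balaban`, lineage `t4-ne7-p1` (CRUX PROVER NE7 #1 = OWNER of row NE7), gen 73; THE END of the sup-member road
`t4/b2b-balaban-t4-ne7-p1-g73/REP-FLAT-ROAD-v2.md` §2 — the multi-level induction `L(j)`, `j = 0 … k+1`, composed BY NAME from: step 0 = the pinned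
hierarchical axial gauge with its intrinsic level data (`NE7AxialGaugeData.exists_axialGauge_data`), the straight-segment letter of the iterated average
(`NE7IteratedAverageSegment.norm_cavgIter_sub_seg_le`), the nonlinear step (`NE7SliceStepNonlinear.sliceStep_nonlinear`: linear Landau step on the
T4-tangent slice + row NE3's quadratic remainder + gauge-step letters + p2's corner-gauge pinning (154e)), the real bookkeeping
(`NE7SliceInductionRates.step_rates`), row NE3's closed form of the class radii (`NE3ClassRadiusFamily`), and the corner covariance of the average
(`NE3ResidualSliceRep.cavgIter_gaugeAct_of_cornerTrivial`).

THE STATEMENT (`exists_pinned_sup_gauge`, dimension `d+1`, `L ≥ 2`): `∃ C θ₀ > 0` such that for all `k`, `N ≥ 1`, every unitary `(L^{k+1}N)`-periodic `U`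
with `SmallField U ε`, `0 ≤ ε`, `cavgIter L (k+1) U = 1` and `(L^{k+1})²·ε ≤ θ₀` there is `g` unitary, `(L^{k+1}N)`-periodic, `g(L^{k+1}z) = 1`,
`cavgIter L (k+1) U^g = 1`, and `‖U^g(y,κ) − 1‖ ≤ C·L^{k+1}·ε` for every link.  This is the hypothesis `hr₀` of THE END (155)∕G7
`NE7ApeTrivialFlatEndLinks.smallField_of_trivialLetters_links` with `r₀ = Cδ∕M` — the SUP member of REP♭⁻ at the trivial flat datum; the GRADIENT
member `r₁` (one exact Landau step at the top, [Balaban1985RegularSpaces] Prop. 5 TYPE) is NOT here.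

HONEST FRAMING (page 1): OUR road (not Bałaban's (1.65)–(1.69) induction verbatim: the gauge is re-pinned at every level by interpolation instead of
by the constrained Landau condition); everything [folklore] over the tree BY NAME; 0 def, 0 sorry.  REP♭ (sup AND gradient) is NOT proved — only its
sup member; (APE) NOT proved; NE7 NOT PRINTED ∕ NOT PROVED (0∕1); spine PROVED 0∕9; finite T⁴ rung (B)+1 — NOT infinite volume, NOT mass gap, NOT
BetaPertH, NOT Clay.  PLACEMENT: our lemma, under `Summits/QuantumFields/BalabanUV/`.
Continuum YM on T⁴ ⇐ BetaPertH ∧ nine spine estimates (0/9 proved); BetaPertH ⇐ (D1) ∧ (D4) ∧ CAP+tail; G-an2-4 gates asym, D1 and NE2/3/4.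
-/

set_option autoImplicit false

open scoped BigOperators Matrix Matrix.Norms.L2Operator
open NormedSpace Finset

namespace Summit.QuantumFields.BalabanUV.T4Continuum.NE7SliceInduction

open Literature.MathematicalPhysics.QuantumFieldTheory.Balaban1983to89
open B7Prop1Explicit B7Prop2Explicit
open T4AveragingDeficitWall (IsUnitaryCfg SmallField)
open T4AveragingDeficitWallBoundary (IsPeriodicCfg)
open AveragingDeficitTwoLevelPrep (twoLevelSmall)
open AveragingDeficitMultiLevelPrep (cavgIter LevelSmall radIter)
open AveragingDeficitKDatum (isUnitaryCfg_gaugeAct)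
open BlockAveragePushDirSplit (flat)
open BlockAverageVaryDisc (rho0 rho0_pos)
open SpreadLift (loopRad)
open NE3EnergyShapes (IsUnitarySite IsPeriodicSite)
open NE3FramePotBoundW (levelSmall_of_le)
open BlockAverageCurrent (smallField_gaugeAct)
open NE3ResidualSliceRep (cavgIter_gaugeAct_of_cornerTrivial isPeriodicCfg_gaugeAct)
open NE3ClassRadiusFamily (radIter_radSum_le_of_small levelSmall_of_small)
open NE7IteratedAverageSegment (norm_cavgIter_sub_seg_le)
open NE7AxialGaugeData (exists_axialGauge_data)
open NE7SliceStepNonlinear (sliceStep_nonlinear)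
open NE7SliceInductionRates (step_rates)

noncomputable section

variable {d : ℕ} {n : Type} [Fintype n] [DecidableEq n]

/-! ## §1 Closed forms of the class radii sums -/

/-- `Σ_{m ≤ i} L^m ≤ 2·L^i` for `L ≥ 2`. [folklore] -/
theorem sum_pow_le {L : ℝ} (hL : 2 ≤ L) : ∀ i : ℕ, ∑ m ∈ range (i + 1), L ^ m ≤ 2 * L ^ i
  | 0 => by simp
  | i + 1 => by
    rw [sum_range_succ]
    have ih := sum_pow_le hL i
    have hLi : 0 ≤ L ^ i := by positivity
    calc ∑ m ∈ range (i + 1), L ^ m + L ^ (i + 1) ≤ 2 * L ^ i + L ^ (i + 1) := by linarith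
      _ ≤ 2 * L ^ (i + 1) := by rw [pow_succ]; nlinarith

/-- **The straight-segment radius sum in closed form**: `Σ_{m≤i} L^{i−m}·4·loopRad(radIter m ε) ≤ 256(D+1)(D+4)·(L^{i+1})²·ε` (`D = d+1`) for `i ≤ k`,
under the class line `14464(D+1)²(D+4)²·(8∕3)·(L^{k+1})²ε ≤ 1∕2` (row NE3 `radIter ≤ 2(L²)^m ε`). [folklore] -/
theorem segSum_le {L : ℕ} (hL : 2 ≤ L) {k i : ℕ} (hik : i ≤ k) {ε : ℝ} (hε : 0 ≤ ε)
    (hA₁ : 14464 * (((d + 1 : ℕ) : ℝ) + 1) ^ 2 * (((d + 1 : ℕ) : ℝ) + 4) ^ 2 * (8 / 3) * (((L : ℝ) ^ (k + 1)) ^ 2 * ε) ≤ 1 / 2) :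
    ∑ m ∈ range (i + 1), (L : ℝ) ^ (i - m) * (4 * loopRad (d + 1) L (radIter (d + 1) L m ε))
      ≤ 256 * ((((d + 1 : ℕ) : ℝ) + 1) * (((d + 1 : ℕ) : ℝ) + 4)) * ((L : ℝ) ^ (i + 1)) ^ 2 * ε := by
  have hL2 : (2 : ℝ) ≤ L := by exact_mod_cast hL
  have hL1 : (1 : ℝ) ≤ L := by linarith
  have hLsq : (1 : ℝ) ≤ (L : ℝ) ^ 2 := one_le_pow₀ hL1
  set D : ℝ := ((d + 1 : ℕ) : ℝ) with hD
  have hD0 : 0 ≤ D := Nat.cast_nonneg _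
  -- `radIter m ε ≤ 2(L²)^m ε` for `m ≤ k`
  have hrad : ∀ m, m ≤ k → radIter (d + 1) L m ε ≤ 2 * (((L : ℝ) ^ 2) ^ m * ε) := by
    intro m hm
    refine (radIter_radSum_le_of_small (d := d + 1) hL m hε ?_).1
    have hmono : ((L : ℝ) ^ 2) ^ m * ε ≤ ((L : ℝ) ^ 2) ^ k * ε := mul_le_mul_of_nonneg_right (pow_le_pow_right₀ hLsq hm) hε
    have hk : (L : ℝ) ^ 2 * (((L : ℝ) ^ 2) ^ k * ε) = ((L : ℝ) ^ (k + 1)) ^ 2 * ε := by ring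
    calc 14464 * (D + 1) ^ 2 * (D + 4) ^ 2 * (L : ℝ) ^ 2 * (8 / 3 * (((L : ℝ) ^ 2) ^ m * ε))
        ≤ 14464 * (D + 1) ^ 2 * (D + 4) ^ 2 * (L : ℝ) ^ 2 * (8 / 3 * (((L : ℝ) ^ 2) ^ k * ε)) := by gcongr
      _ = 14464 * (D + 1) ^ 2 * (D + 4) ^ 2 * (8 / 3) * (((L : ℝ) ^ (k + 1)) ^ 2 * ε) := by rw [← hk]; ring
      _ ≤ 1 / 2 := hA₁
  -- termwise
  have hterm : ∀ m ∈ range (i + 1), (L : ℝ) ^ (i - m) * (4 * loopRad (d + 1) L (radIter (d + 1) L m ε))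
      ≤ (128 * ((D + 1) * (D + 4)) * (L : ℝ) ^ 2 * (L : ℝ) ^ i * ε) * (L : ℝ) ^ m := by
    intro m hm
    have hmi : m ≤ i := Nat.lt_succ_iff.mp (mem_range.mp hm)
    have hr := hrad m (hmi.trans hik)
    have hlr : loopRad (d + 1) L (radIter (d + 1) L m ε) ≤ 16 * ((D + 1) * (D + 4)) * (L : ℝ) ^ 2 * (2 * (((L : ℝ) ^ 2) ^ m * ε)) := by
      simp only [loopRad, hD]
      have h16 : 0 ≤ 2 * (8 * (((d + 1 : ℕ) : ℝ) + 1) * (((d + 1 : ℕ) : ℝ) + 4) * (L : ℝ) ^ 2) := by positivity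
      calc 2 * (8 * (((d + 1 : ℕ) : ℝ) + 1) * (((d + 1 : ℕ) : ℝ) + 4) * (L : ℝ) ^ 2 * radIter (d + 1) L m ε)
          = 2 * (8 * (((d + 1 : ℕ) : ℝ) + 1) * (((d + 1 : ℕ) : ℝ) + 4) * (L : ℝ) ^ 2) * radIter (d + 1) L m ε := by ring
        _ ≤ 2 * (8 * (((d + 1 : ℕ) : ℝ) + 1) * (((d + 1 : ℕ) : ℝ) + 4) * (L : ℝ) ^ 2) * (2 * (((L : ℝ) ^ 2) ^ m * ε)) :=
            mul_le_mul_of_nonneg_left hr h16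
        _ = 16 * ((((d + 1 : ℕ) : ℝ) + 1) * (((d + 1 : ℕ) : ℝ) + 4)) * (L : ℝ) ^ 2 * (2 * (((L : ℝ) ^ 2) ^ m * ε)) := by ring
    have hpow : (L : ℝ) ^ (i - m) * ((L : ℝ) ^ 2) ^ m = (L : ℝ) ^ i * (L : ℝ) ^ m := by
      rw [← pow_mul, ← pow_add, ← pow_add]; congr 1; omega
    calc (L : ℝ) ^ (i - m) * (4 * loopRad (d + 1) L (radIter (d + 1) L m ε))
        ≤ (L : ℝ) ^ (i - m) * (4 * (16 * ((D + 1) * (D + 4)) * (L : ℝ) ^ 2 * (2 * (((L : ℝ) ^ 2) ^ m * ε)))) := by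
          gcongr
      _ = (128 * ((D + 1) * (D + 4)) * (L : ℝ) ^ 2 * ε) * ((L : ℝ) ^ (i - m) * ((L : ℝ) ^ 2) ^ m) := by ring
      _ = (128 * ((D + 1) * (D + 4)) * (L : ℝ) ^ 2 * (L : ℝ) ^ i * ε) * (L : ℝ) ^ m := by rw [hpow]; ring
  calc ∑ m ∈ range (i + 1), (L : ℝ) ^ (i - m) * (4 * loopRad (d + 1) L (radIter (d + 1) L m ε))
      ≤ ∑ m ∈ range (i + 1), (128 * ((D + 1) * (D + 4)) * (L : ℝ) ^ 2 * (L : ℝ) ^ i * ε) * (L : ℝ) ^ m := sum_le_sum hterm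
    _ = (128 * ((D + 1) * (D + 4)) * (L : ℝ) ^ 2 * (L : ℝ) ^ i * ε) * ∑ m ∈ range (i + 1), (L : ℝ) ^ m := by rw [mul_sum]
    _ ≤ (128 * ((D + 1) * (D + 4)) * (L : ℝ) ^ 2 * (L : ℝ) ^ i * ε) * (2 * (L : ℝ) ^ i) :=
        mul_le_mul_of_nonneg_left (sum_pow_le hL2 i) (by positivity)
    _ = 256 * ((D + 1) * (D + 4)) * ((L : ℝ) ^ (i + 1)) ^ 2 * ε := by ring

/-! ## §2 THE END: the sup member of REP♭ at the trivial flat datum -/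

/-- **THE SUP MEMBER OF REP♭ AT THE TRIVIAL FLAT DATUM, UNIFORMLY IN `k` AND `N`** (see the module doc): `∃ C θ₀ > 0` (functions of `d`, `card n`, `L`)
such that every unitary `(L^{k+1}N)`-periodic `U` with `SmallField U ε`, `cavgIter L (k+1) U = 1` and `(L^{k+1})²ε ≤ θ₀` has a unitary periodic gauge
`g` pinned at the top corners, keeping the flat top, with all links of `U^g` within `C·L^{k+1}·ε` of `1`. [folklore] -/
theorem exists_pinned_sup_gauge [Nonempty n] {L : ℕ} (hL : 2 ≤ L) :
    ∃ C θ₀ : ℝ, 0 < C ∧ 0 < θ₀ ∧ ∀ (k N : ℕ) [NeZero N] (U : Site (d + 1) → Fin (d + 1) → (Matrix n n ℂ)ˣ) (ε : ℝ),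
      IsUnitaryCfg U → 0 ≤ ε → SmallField U ε → IsPeriodicCfg U ((L ^ (k + 1) * N : ℕ) : ℤ) → cavgIter L (k + 1) U = flat →
      ((L : ℝ) ^ (k + 1)) ^ 2 * ε ≤ θ₀ →
      ∃ g : Site (d + 1) → (Matrix n n ℂ)ˣ, IsUnitarySite g ∧ IsPeriodicSite g ((L ^ (k + 1) * N : ℕ) : ℤ) ∧
        (∀ z : Site (d + 1), g (((L ^ (k + 1) : ℕ) : ℤ) • z) = 1) ∧ cavgIter L (k + 1) (gaugeAct g U) = flat ∧
        ∀ (y : Site (d + 1)) (κ : Fin (d + 1)), ‖((gaugeAct g U y κ : (Matrix n n ℂ)ˣ) : Matrix n n ℂ) - 1‖ ≤ C * (L : ℝ) ^ (k + 1) * ε := by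
  have hL1 : 1 ≤ L := by omega
  have hL2r : (2 : ℝ) ≤ L := by exact_mod_cast hL
  have hL1r : (1 : ℝ) ≤ L := by linarith
  have hL0r : (0 : ℝ) < L := by linarith
  -- the constants
  set D : ℝ := ((d + 1 : ℕ) : ℝ) with hDdef
  have hD0 : 0 ≤ D := Nat.cast_nonneg _
  set cS : ℝ := 256 * ((D + 1) * (D + 4)) with hcS
  have hcS0 : 0 ≤ cS := by positivity
  set cb : ℝ := 2 * D + 2 * cS with hcb
  set cη : ℝ := 2 * D + 3 * cS with hcη
  set ca : ℝ := D + cS with hca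
  set C₂ : ℝ := 4 * (3 + 12 * D) ^ 3 / rho0 (d + 1) L ^ 2 with hC₂
  have hρ0 : 0 < rho0 (d + 1) L := rho0_pos hL1
  set A₁ : ℝ := 14464 * (D + 1) ^ 2 * (D + 4) ^ 2 * (8 / 3) with hA₁
  set A₂ : ℝ := 2 * twoLevelSmall (d + 1) L with hA₂
  have htls0 : 0 ≤ twoLevelSmall (d + 1) L := by unfold twoLevelSmall; positivity
  obtain ⟨K₁, K₂, K₃, hK₁, hK₂, hK₃, hstep⟩ := sliceStep_nonlinear (d := d) (n := n)
  obtain ⟨θ₀, hθ₀, hrates⟩ := step_rates (A₁ := A₁) (A₂ := A₂) hK₁.le hK₂.le hK₃.le (by positivity : 0 ≤ C₂) (by positivity : 0 ≤ cb)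
    (by positivity : 0 ≤ cη) (by positivity : 0 ≤ ca) hD0 hρ0 hL1r
  set C' : ℝ := 18 * K₁ + 36 * K₂ * cb + 8 * cη + ca + 1 with hC'
  have hC'ca : ca ≤ C' := by
    rw [hC']
    have : 0 ≤ 18 * K₁ + 36 * K₂ * cb + 8 * cη := by positivity
    linarith
  refine ⟨C', θ₀, by rw [hC']; positivity, hθ₀, ?_⟩
  intro k N _ U ε hUu hε hUε hUP hflat hθ
  set M : ℝ := (L : ℝ) ^ (k + 1) with hMdef
  have hM1 : 1 ≤ M := one_le_pow₀ hL1r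
  have hM0 : 0 < M := by positivity
  have hMn : ((L ^ (k + 1) : ℕ) : ℝ) = M := by rw [hMdef]; push_cast; ring
  set θ : ℝ := M ^ 2 * ε with hθdef
  have hθ0 : 0 ≤ θ := by positivity
  obtain ⟨hA₁θ, hA₂θ, hcbθ, hR⟩ := hrates θ hθ0 hθ
  -- the multi-level class from the two class lines
  have hLsq : (1 : ℝ) ≤ (L : ℝ) ^ 2 := one_le_pow₀ hL1r
  have hθk : ((L : ℝ) ^ 2) ^ k * ε ≤ θ := by
    have h1 : ((L : ℝ) ^ 2) ^ k * ε ≤ ((L : ℝ) ^ 2) ^ (k + 1) * ε := mul_le_mul_of_nonneg_right (pow_le_pow_right₀ hLsq (Nat.le_succ k)) hε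
    have h2 : ((L : ℝ) ^ 2) ^ (k + 1) * ε = θ := by rw [hθdef, hMdef]; ring
    linarith
  have hs : LevelSmall (d + 1) L k ε := by
    refine levelSmall_of_small (d := d + 1) hL k hε ?_ ?_
    · have hk : (L : ℝ) ^ 2 * (((L : ℝ) ^ 2) ^ k * ε) = θ := by rw [hθdef, hMdef]; ring
      calc 14464 * (D + 1) ^ 2 * (D + 4) ^ 2 * (L : ℝ) ^ 2 * (8 / 3 * (((L : ℝ) ^ 2) ^ k * ε))
          = A₁ * ((L : ℝ) ^ 2 * (((L : ℝ) ^ 2) ^ k * ε)) := by rw [hA₁]; ring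
        _ = A₁ * θ := by rw [hk]
        _ ≤ 1 / 2 := hA₁θ
    · calc 2 * twoLevelSmall (d + 1) L * (((L : ℝ) ^ 2) ^ k * ε) ≤ 2 * twoLevelSmall (d + 1) L * θ :=
            mul_le_mul_of_nonneg_left hθk (by positivity)
        _ = A₂ * θ := by rw [hA₂]
        _ ≤ 1 := hA₂θ
  have hA₁' : 14464 * (((d + 1 : ℕ) : ℝ) + 1) ^ 2 * (((d + 1 : ℕ) : ℝ) + 4) ^ 2 * (8 / 3) * (((L : ℝ) ^ (k + 1)) ^ 2 * ε) ≤ 1 / 2 := by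
    rw [← hDdef]; exact hA₁θ
  -- step 0: the pinned axial gauge and the intrinsic level data
  obtain ⟨u, huU, huP, hupin, huflat, -, hulinks, hulevel⟩ := exists_axialGauge_data hL1 k N hUu hε hs hUε hUP hflat
  set V := gaugeAct u U with hVdef
  have hVu : IsUnitaryCfg V := isUnitaryCfg_gaugeAct huU hUu
  have hVP : IsPeriodicCfg V ((L ^ (k + 1) * N : ℕ) : ℤ) := isPeriodicCfg_gaugeAct huP hUP
  have hVε : SmallField V ε := smallField_gaugeAct huU hUε
  -- closed forms of the level data
  have hSk : ∑ m ∈ range (k + 1), (L : ℝ) ^ (k - m) * (4 * loopRad (d + 1) L (radIter (d + 1) L m ε)) ≤ cS * θ := by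
    have h := segSum_le (d := d) hL le_rfl hε hA₁'
    rw [hcS, hθdef, hMdef, hDdef]; linarith
  have hSi : ∀ i, i ≤ k → ∑ m ∈ range (i + 1), (L : ℝ) ^ (i - m) * (4 * loopRad (d + 1) L (radIter (d + 1) L m ε)) ≤ cS * θ := by
    intro i hik
    have h := segSum_le (d := d) hL hik hε hA₁'
    have hΛM : ((L : ℝ) ^ (i + 1)) ^ 2 ≤ M ^ 2 := by
      rw [hMdef]; exact pow_le_pow_left₀ (by positivity) (pow_le_pow_right₀ hL1r (by omega)) 2
    have h2 : 256 * ((((d + 1 : ℕ) : ℝ) + 1) * (((d + 1 : ℕ) : ℝ) + 4)) * ((L : ℝ) ^ (i + 1)) ^ 2 * ε ≤ cS * θ := by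
      rw [hcS, hθdef, hDdef]
      have h3 := mul_le_mul_of_nonneg_right hΛM hε
      have h4 : 0 ≤ 256 * ((((d + 1 : ℕ) : ℝ) + 1) * (((d + 1 : ℕ) : ℝ) + 4)) := by positivity
      calc 256 * ((((d + 1 : ℕ) : ℝ) + 1) * (((d + 1 : ℕ) : ℝ) + 4)) * ((L : ℝ) ^ (i + 1)) ^ 2 * ε
          = 256 * ((((d + 1 : ℕ) : ℝ) + 1) * (((d + 1 : ℕ) : ℝ) + 4)) * (((L : ℝ) ^ (i + 1)) ^ 2 * ε) := by ring
        _ ≤ 256 * ((((d + 1 : ℕ) : ℝ) + 1) * (((d + 1 : ℕ) : ℝ) + 4)) * (M ^ 2 * ε) := mul_le_mul_of_nonneg_left h3 h4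
    exact h.trans h2
  have hbase : (((L ^ (k + 1) : ℕ) : ℝ) + 1) * (((d + 1 : ℕ) : ℝ) * (((L ^ (k + 1) : ℕ) : ℝ) - 1)) * ε ≤ D * θ := by
    rw [hMn, ← hDdef, hθdef]
    have : (M + 1) * (D * (M - 1)) * ε = D * (M ^ 2 * ε) - D * ε := by ring
    rw [this]
    have : 0 ≤ D * ε := by positivity
    linarith
  have ha0 : ∀ (y : Site (d + 1)) (κ : Fin (d + 1)), ‖((V y κ : (Matrix n n ℂ)ˣ) : Matrix n n ℂ) - 1‖ ≤ ca * θ := by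
    intro y κ
    have h := hulinks y κ
    rw [hca, add_mul]
    exact h.trans (add_le_add hbase hSk)
  have hb : ∀ i, i ≤ k → ∀ (z : Site (d + 1)) (κ : Fin (d + 1)),
      ‖((cavgIter L (i + 1) V z κ : (Matrix n n ℂ)ˣ) : Matrix n n ℂ) - 1‖ ≤ cb * θ := by
    intro i hik z κ
    have h := hulevel i hik z κ
    have hΛ : (((L ^ (i + 1) : ℕ) : ℝ) - 1) * (((d + 1 : ℕ) : ℝ) * (((L ^ (k + 1) : ℕ) : ℝ) - 1) * ε) ≤ D * θ := by
      rw [hMn, ← hDdef, hθdef]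
      have hΛM : ((L ^ (i + 1) : ℕ) : ℝ) ≤ M := by
        rw [hMdef]; push_cast; exact pow_le_pow_right₀ hL1r (by omega)
      have hΛ1 : (1 : ℝ) ≤ ((L ^ (i + 1) : ℕ) : ℝ) := by exact_mod_cast Nat.one_le_pow _ _ hL1
      have h1 : (((L ^ (i + 1) : ℕ) : ℝ) - 1) * (D * (M - 1) * ε) ≤ M * (D * (M - 1) * ε) :=
        mul_le_mul_of_nonneg_right (by linarith) (mul_nonneg (mul_nonneg hD0 (by linarith)) hε)
      have h2 : M * (D * (M - 1) * ε) = D * (M ^ 2 * ε) - D * M * ε := by ring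
      have h3 : 0 ≤ D * M * ε := by positivity
      linarith
    rw [hcb]
    calc _ ≤ D * θ + (D * θ + cS * θ) + cS * θ := h.trans (add_le_add (add_le_add hΛ (add_le_add hbase hSk)) (hSi i hik))
      _ = (2 * D + 2 * cS) * θ := by ring
  have hη : ∀ i, i ≤ k → ∀ (z : Site (d + 1)) (κ : Fin (d + 1)),
      ‖((hol V (((L ^ (i + 1) : ℕ) : ℤ) • z) (seg κ ((L ^ (i + 1) : ℕ) : ℤ)) : (Matrix n n ℂ)ˣ) : Matrix n n ℂ) - 1‖ ≤ cη * θ := by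
    intro i hik z κ
    have hseg := norm_cavgIter_sub_seg_le hL1 i hVu hε (levelSmall_of_le hik hs) hVε z κ
    have h1 := hb i hik z κ
    rw [hcη]
    calc ‖((hol V (((L ^ (i + 1) : ℕ) : ℤ) • z) (seg κ ((L ^ (i + 1) : ℕ) : ℤ)) : (Matrix n n ℂ)ˣ) : Matrix n n ℂ) - 1‖
        ≤ ‖((cavgIter L (i + 1) V z κ : (Matrix n n ℂ)ˣ) : Matrix n n ℂ)
            - ((hol V (((L ^ (i + 1) : ℕ) : ℤ) • z) (seg κ ((L ^ (i + 1) : ℕ) : ℤ)) : (Matrix n n ℂ)ˣ) : Matrix n n ℂ)‖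
          + ‖((cavgIter L (i + 1) V z κ : (Matrix n n ℂ)ˣ) : Matrix n n ℂ) - 1‖ := by
          rw [← norm_neg (_ - ((hol V _ _ : (Matrix n n ℂ)ˣ) : Matrix n n ℂ)), neg_sub]
          exact norm_sub_le_norm_sub_add_norm_sub _ _ _
      _ ≤ cS * θ + (2 * D + 2 * cS) * θ := add_le_add ((hseg.trans (hSi i hik))) (by rw [← hcb]; exact h1)
      _ = (2 * D + 3 * cS) * θ := by ring
  -- THE INDUCTION over the levels `j ≤ k + 1`
  have main : ∀ j : ℕ, j ≤ k + 1 → ∃ g : Site (d + 1) → (Matrix n n ℂ)ˣ, IsUnitarySite g ∧ IsPeriodicSite g ((L ^ (k + 1) * N : ℕ) : ℤ) ∧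
      (∀ z : Site (d + 1), g (((L ^ j : ℕ) : ℤ) • z) = 1) ∧
      ∀ (y : Site (d + 1)) (κ : Fin (d + 1)), ‖((gaugeAct g V y κ : (Matrix n n ℂ)ˣ) : Matrix n n ℂ) - 1‖ ≤ C' * θ / (L : ℝ) ^ j := by
    intro j
    induction j with
    | zero =>
      intro _
      refine ⟨fun _ => 1, fun _ => (unitaryUnits _).one_mem, fun _ _ => rfl, fun _ => rfl, fun y κ => ?_⟩
      rw [NE3EnergyShapes.gaugeAct_one, pow_zero, div_one]
      exact (ha0 y κ).trans (mul_le_mul_of_nonneg_right hC'ca hθ0)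
    | succ i ih =>
      intro hi1
      have hik : i ≤ k := by omega
      obtain ⟨g, hgu, hgP, hgpin, hglinks⟩ := ih (by omega)
      -- the running constants at level `i + 1`
      set Λ : ℝ := (L : ℝ) ^ (i + 1) with hΛdef
      have hΛ1 : 1 ≤ Λ := one_le_pow₀ hL1r
      have hΛM : Λ ≤ M := by rw [hΛdef, hMdef]; exact pow_le_pow_right₀ hL1r (by omega)
      have hΛ0 : 0 < Λ := by positivity
      set a : ℝ := C' * L * θ / Λ with hadef
      have haeq : C' * θ / (L : ℝ) ^ i = a := by
        rw [hadef, hΛdef, pow_succ]; field_simp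
      have hga : ∀ (y : Site (d + 1)) (κ : Fin (d + 1)), ‖((gaugeAct g V y κ : (Matrix n n ℂ)ˣ) : Matrix n n ℂ) - 1‖ ≤ a :=
        fun y κ => (hglinks y κ).trans_eq haeq
      set b : ℝ := cb * θ with hbdef
      set h : ℝ := cη * θ with hhdef
      set ρ : ℝ := K₁ * Λ * (θ / M ^ 2 + 32 * (2 * a) ^ 2) + K₂ * (2 * b + C₂ * (Λ * (2 * a)) ^ 2) / Λ with hρdef
      set t : ℝ := K₃ * (Λ * (2 * a) + (2 * b + C₂ * (Λ * (2 * a)) ^ 2) + Λ ^ 2 * (θ / M ^ 2 + 32 * (2 * a) ^ 2)) with htdef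
      obtain ⟨c1, c2, c3, c4, c5, c6⟩ := hR Λ M b h hΛ1 hΛM (by positivity) le_rfl (by positivity) le_rfl a ρ t
        (by rw [hadef, hC']) rfl rfl
      have hεeq : ε = θ / M ^ 2 := by rw [hθdef]; field_simp
      obtain ⟨g', hg'u, hg'P, hg'pin, hg'links⟩ := hstep L hL k N i hik V ε hVu hε hs hVε hVP g hgu hgP hgpin a b h hga
        (fun z κ => hb i hik z κ) (fun z κ => hη i hik z κ) c1 hcbθ (by rw [← hDdef]; exact c2) ρ t
        (by rw [hρdef, hC₂, hDdef, ← hεeq]) (by rw [htdef, hC₂, hDdef, ← hεeq]) c3 c4 (by rw [← hDdef]; exact c5)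
      refine ⟨g', hg'u, hg'P, hg'pin, fun y κ => (hg'links y κ).trans ?_⟩
      calc 9 * (2 * ρ + 8 * (t + (ρ + 2 * a)) * (ρ + 2 * a)) + 8 * h / (L : ℝ) ^ (i + 1) ≤ C' * θ / Λ := c6
        _ = C' * θ / (L : ℝ) ^ (i + 1) := by rw [hΛdef]
  -- THE END at `j = k + 1`
  obtain ⟨g, hgu, hgP, hgpin, hglinks⟩ := main (k + 1) le_rfl
  refine ⟨fun y => g y * u y, fun y => (unitaryUnits _).mul_mem (hgu y) (huU y), fun y ι => by simp only [hgP y ι, huP], fun z => ?_, ?_, ?_⟩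
  · show g (((L ^ (k + 1) : ℕ) : ℤ) • z) * u (((L ^ (k + 1) : ℕ) : ℤ) • z) = 1
    rw [hgpin, hupin, one_mul]
  · have hfac : gaugeAct (fun y => g y * u y) U = gaugeAct g V := by
      funext y μ; simp only [hVdef, gaugeAct, mul_inv_rev, mul_assoc]
    have hgpin' : ∀ z : Site (d + 1), g (((L : ℤ) ^ (k + 1)) • z) = 1 := fun z => by
      rw [show (L : ℤ) ^ (k + 1) = ((L ^ (k + 1) : ℕ) : ℤ) by push_cast; ring]; exact hgpin z
    rw [hfac, cavgIter_gaugeAct_of_cornerTrivial hL1 k hVu hε hs hVε hgu hgpin', hVdef, huflat]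
  · intro y κ
    have hfac : gaugeAct (fun y => g y * u y) U y κ = gaugeAct g V y κ := by
      simp only [hVdef, gaugeAct, mul_inv_rev, mul_assoc]
    rw [hfac]
    refine (hglinks y κ).trans (le_of_eq ?_)
    rw [hθdef, hMdef, div_eq_iff (by positivity)]
    ring

end

end Summit.QuantumFields.BalabanUV.T4Continuum.NE7SliceInduction
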